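import Mathlib.Analysis.SpecialFunctions.Trigonometric.InverseDeriv
import Mathlib.Analysis.SpecialFunctions.Sqrt
import Mathlib.Analysis.Convex.Deriv
import Mathlib.Analysis.Convex.Jensen
import HarnessLib

/-!
# The polar angle function `A_k(u) = arccos (cos u / √(cos² u + k² sin² u))`

Topic `Literature/Geometry/DiscreteGeometry`.  Brick FT-A of Fejes Tóth's bound for the Tammes
problem (`d_N ≤ arccos ((cot² ω_N − 1)/2)`, `ω_N = Nπ/(6(N−2))`; L. Fejes Tóth 1943, Böröczky
2004 §4.1 Lemma 4.1.5 "the triangle bound"): the one real function through which all areas of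
ISOSCELES spherical triangles are expressed.  For an isosceles spherical triangle with two sides
of length `ℓ`, `k = cos ℓ`, enclosing the apex angle `2u`, the base angles are `π/2 − A_k(u)`
and the area is `2(u − A_k(u))` (proved geometrically in a sibling file); a triangle inscribed
in a circle of angular radius `R` with half-arcs `φ₁ + φ₂ + φ₃ = π` has area
`2π − 2 Σ A_{cos R}(φᵢ)`.  This file is pure real analysis (no geometry), everything PROVED:

* `polarDen k u = cos² u + k² sin² u` (`= 1 − (1 − k²) sin² u`), `polarAngle k u = A_k(u)`;
  values `A_k(0) = 0`, `A_k(π/2) = π/2`, symmetry `A_k(π − u) = π − A_k(u)`, `cos`/`sin` of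
  `A_k`, range lemmas;
* `hasDerivAt_polarAngle`: **`A_k'(u) = k / (cos² u + k² sin² u)`** on `(0, π)` (`0 < k`);
* `polarAngle_add_polarAngle_le` — **the endpoint lemma**: for `0 < k < 1`, `0 < S < π` and
  `a ≤ t ≤ S − a`, `A_k(t) + A_k(S − t) ≤ A_k(a) + A_k(S − a)` (on an arc of total half-angle
  `S`, splitting it as unevenly as allowed MAXIMISES `A + A`, i.e. minimises the area) — the
  sliding step of the triangle bound;
* `concaveOn_sub_polarAngle`: `u ↦ u − A_k(u)` is concave on `[0, π/2]` (the area of an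
  isosceles triangle is a concave function of its apex angle), with `min_le_sub_polarAngle`;
* `polarAngle_sub_polarAngle_half`: the identity **`A_k(α) − A_k(α/2) = α/2`** for
  `cos α = k/(1 + k)` — the isosceles triangle with sides `d, d` and apex angle `2α(d)`
  (`α(d) = arccos (cos d/(1 + cos d))` the angle of the equilateral triangle of side `d`) has
  the same area as the equilateral one (it is the union of two equilateral triangles minus a
  congruent copy of itself).

## References
* L. Fejes Tóth, *Über die Abschätzung des kürzesten Abstandes zweier Punkte eines auf einer
  Kugelfläche liegenden Punktsystems*, Jber. DMV 53 (1943) 66–68. [folklore]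
* K. Böröczky Jr., *Finite Packing and Covering*, Cambridge Tracts 154, CUP 2004, §4.1
  (Lemma 4.1.5), §4.4. [`Boroczky2004`]
-/

noncomputable section

namespace Literature.Geometry.DiscreteGeometry

open Real Set

/-! ### Definitions and values -/

/-- The denominator `D_k(u) = cos² u + k² sin² u`. [folklore] -/
def polarDen (k u : ℝ) : ℝ := cos u ^ 2 + k ^ 2 * sin u ^ 2

/-- **The polar angle function** `A_k(u) = arccos (cos u / √(cos² u + k² sin² u))` — the
argument of the point `(cos u, k sin u)`; `π/2 − A_k(u)` is the base angle of an isosceles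
spherical triangle with equal sides `ℓ` (`k = cos ℓ`) and apex angle `2u`. [folklore] -/
def polarAngle (k u : ℝ) : ℝ := arccos (cos u / Real.sqrt (polarDen k u))

/-- `D_k(u) = 1 − (1 − k²) sin² u`. [folklore] -/
theorem polarDen_eq (k u : ℝ) : polarDen k u = 1 - (1 - k ^ 2) * sin u ^ 2 := by
  unfold polarDen
  nlinarith [sin_sq_add_cos_sq u]

/-- `D_k` is even about `π/2`: `D_k(π − u) = D_k(u)`. [folklore] -/
theorem polarDen_pi_sub (k u : ℝ) : polarDen k (π - u) = polarDen k u := by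
  unfold polarDen; rw [cos_pi_sub, sin_pi_sub]; ring

/-- `D_k(u) > 0` for `k ≠ 0`. [folklore] -/
theorem polarDen_pos {k : ℝ} (hk : k ≠ 0) (u : ℝ) : 0 < polarDen k u := by
  unfold polarDen
  have hk2 : 0 < k ^ 2 := by positivity
  rcases (sq_nonneg (sin u)).eq_or_lt with h | h
  · have hs : sin u = 0 := by
      have := h.symm; rwa [sq_eq_zero_iff] at this
    have hc : cos u ^ 2 = 1 := by nlinarith [sin_sq_add_cos_sq u]
    rw [← h, hc]; norm_num
  · nlinarith [sq_nonneg (cos u), mul_pos hk2 h]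

/-- `D_k(u) ≤ 1` for `k² ≤ 1`. [folklore] -/
theorem polarDen_le_one {k : ℝ} (hk : k ^ 2 ≤ 1) (u : ℝ) : polarDen k u ≤ 1 := by
  rw [polarDen_eq]
  nlinarith [sq_nonneg (sin u)]

/-- `cos² u ≤ D_k(u)`. [folklore] -/
theorem cos_sq_le_polarDen (k u : ℝ) : cos u ^ 2 ≤ polarDen k u := by
  unfold polarDen; nlinarith [sq_nonneg k, sq_nonneg (sin u), sq_nonneg (k * sin u)]

/-- The argument of `arccos` lies in `[−1, 1]`. [folklore] -/
theorem abs_cos_div_sqrt_polarDen_le (k u : ℝ) : |cos u / Real.sqrt (polarDen k u)| ≤ 1 := by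
  rcases (Real.sqrt_nonneg (polarDen k u)).eq_or_lt with h | h
  · rw [← h, div_zero, abs_zero]; exact zero_le_one
  · rw [abs_div, abs_of_pos h, div_le_one h]
    exact Real.abs_le_sqrt (cos_sq_le_polarDen k u)

/-- `cos A_k(u) = cos u / √D_k(u)`. [folklore] -/
theorem cos_polarAngle (k u : ℝ) : cos (polarAngle k u) = cos u / Real.sqrt (polarDen k u) := by
  have h := abs_le.1 (abs_cos_div_sqrt_polarDen_le k u)
  exact cos_arccos h.1 h.2

/-- `sin A_k(u) = k sin u / √D_k(u)` when `k sin u ≥ 0` (`k ≠ 0`). [folklore] -/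
theorem sin_polarAngle {k u : ℝ} (hk : k ≠ 0) (hku : 0 ≤ k * sin u) :
    sin (polarAngle k u) = k * sin u / Real.sqrt (polarDen k u) := by
  have hD := polarDen_pos hk u
  have hs : 0 < Real.sqrt (polarDen k u) := Real.sqrt_pos.2 hD
  rw [polarAngle, sin_arccos]
  have : 1 - (cos u / Real.sqrt (polarDen k u)) ^ 2 = (k * sin u / Real.sqrt (polarDen k u)) ^ 2 := by
    rw [div_pow, div_pow, Real.sq_sqrt hD.le]
    field_simp
    unfold polarDen; ring
  rw [this, Real.sqrt_sq (div_nonneg hku hs.le)]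

/-- `0 ≤ A_k(u) ≤ π`. [folklore] -/
theorem polarAngle_nonneg (k u : ℝ) : 0 ≤ polarAngle k u := arccos_nonneg _

/-- `0 ≤ A_k(u) ≤ π`. [folklore] -/
theorem polarAngle_le_pi (k u : ℝ) : polarAngle k u ≤ π := arccos_le_pi _

/-- `A_k(0) = 0`. [folklore] -/
theorem polarAngle_zero (k : ℝ) : polarAngle k 0 = 0 := by
  rw [polarAngle]
  have : polarDen k 0 = 1 := by simp [polarDen]
  rw [this, cos_zero, Real.sqrt_one, div_one, arccos_one]

/-- `A_k(π/2) = π/2`. [folklore] -/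
theorem polarAngle_pi_div_two (k : ℝ) : polarAngle k (π / 2) = π / 2 := by
  rw [polarAngle, cos_pi_div_two, zero_div, arccos_zero]

/-- **Symmetry** `A_k(π − u) = π − A_k(u)`. [folklore] -/
theorem polarAngle_pi_sub (k u : ℝ) : polarAngle k (π - u) = π - polarAngle k u := by
  rw [polarAngle, polarAngle, polarDen_pi_sub, cos_pi_sub, neg_div, arccos_neg]

/-- `A_k(u) ≤ π/2` when `cos u ≥ 0`. [folklore] -/
theorem polarAngle_le_pi_div_two (k : ℝ) {u : ℝ} (hu : 0 ≤ cos u) :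
    polarAngle k u ≤ π / 2 := by
  rw [polarAngle, arccos_le_pi_div_two]
  exact div_nonneg hu (Real.sqrt_nonneg _)

/-- `A_k(u) < π/2` when `cos u > 0` (for `k ≠ 0`). [folklore] -/
theorem polarAngle_lt_pi_div_two {k u : ℝ} (hk : k ≠ 0) (hu : 0 < cos u) :
    polarAngle k u < π / 2 := by
  rw [polarAngle, arccos_lt_pi_div_two]
  exact div_pos hu (Real.sqrt_pos.2 (polarDen_pos hk u))

/-- `0 < A_k(u)` when `sin u ≠ 0` (for `k ≠ 0`). [folklore] -/
theorem polarAngle_pos {k u : ℝ} (hk : k ≠ 0) (hu : sin u ≠ 0) : 0 < polarAngle k u := by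
  rw [polarAngle, arccos_pos]
  have hD := polarDen_pos hk u
  have hs : 0 < Real.sqrt (polarDen k u) := Real.sqrt_pos.2 hD
  rw [div_lt_one hs]
  have hlt : cos u ^ 2 < polarDen k u := by
    unfold polarDen
    have : 0 < k ^ 2 * sin u ^ 2 := by positivity
    linarith
  calc cos u ≤ |cos u| := le_abs_self _
    _ < Real.sqrt (polarDen k u) := by
        rw [← Real.sqrt_sq_eq_abs]
        exact Real.sqrt_lt_sqrt (sq_nonneg _) hlt

/-- Continuity of `A_k` (`k ≠ 0`). [folklore] -/
theorem continuous_polarAngle {k : ℝ} (hk : k ≠ 0) : Continuous (polarAngle k) := by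
  unfold polarAngle polarDen
  refine continuous_arccos.comp (Continuous.div (by fun_prop) (by fun_prop) fun u => ?_)
  exact (Real.sqrt_pos.2 (polarDen_pos hk u)).ne'

/-! ### The derivative -/

/-- `D_k'(u) = −2(1 − k²) sin u cos u`. [folklore] -/
theorem hasDerivAt_polarDen (k u : ℝ) :
    HasDerivAt (polarDen k) (-2 * (1 - k ^ 2) * sin u * cos u) u := by
  have h1 := (hasDerivAt_cos u).fun_pow 2
  have h2 := ((hasDerivAt_sin u).fun_pow 2).const_mul (k ^ 2)
  have h := h1.fun_add h2
  have heq : polarDen k = fun x => cos x ^ 2 + k ^ 2 * sin x ^ 2 := rfl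
  rw [heq]
  refine h.congr_deriv ?_
  norm_num
  ring

/-- **`A_k'(u) = k / D_k(u)` on `(0, π)`** (`0 < k`). [folklore] -/
theorem hasDerivAt_polarAngle {k u : ℝ} (hk : 0 < k) (hu0 : 0 < u) (huπ : u < π) :
    HasDerivAt (polarAngle k) (k / polarDen k u) u := by
  have hsin : 0 < sin u := sin_pos_of_pos_of_lt_pi hu0 huπ
  have hD := polarDen_pos hk.ne' u
  have hs0 : 0 < Real.sqrt (polarDen k u) := Real.sqrt_pos.2 hD
  have hs2 : Real.sqrt (polarDen k u) ^ 2 = polarDen k u := Real.sq_sqrt hD.le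
  have hsder : HasDerivAt (fun x => Real.sqrt (polarDen k x))
      (-2 * (1 - k ^ 2) * sin u * cos u / (2 * Real.sqrt (polarDen k u))) u :=
    (hasDerivAt_polarDen k u).sqrt hD.ne'
  have hfder : HasDerivAt (fun x => cos x / Real.sqrt (polarDen k x))
      ((-sin u * Real.sqrt (polarDen k u) -
          cos u * (-2 * (1 - k ^ 2) * sin u * cos u / (2 * Real.sqrt (polarDen k u)))) /
        Real.sqrt (polarDen k u) ^ 2) u :=
    (hasDerivAt_cos u).fun_div hsder hs0.ne'
  -- the value of `f` is in `(-1, 1)`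
  have hlt : cos u ^ 2 < polarDen k u := by
    unfold polarDen
    have : 0 < k ^ 2 * sin u ^ 2 := by positivity
    linarith
  have hf1 : cos u / Real.sqrt (polarDen k u) ≠ 1 ∧ cos u / Real.sqrt (polarDen k u) ≠ -1 := by
    have habs : |cos u / Real.sqrt (polarDen k u)| < 1 := by
      rw [abs_div, abs_of_pos hs0, div_lt_one hs0, ← Real.sqrt_sq_eq_abs]
      exact Real.sqrt_lt_sqrt (sq_nonneg _) hlt
    have h := abs_lt.1 habs
    exact ⟨h.2.ne, h.1.ne'⟩
  have harc := (hasDerivAt_arccos hf1.2 hf1.1).comp u hfder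
  have heqf : polarAngle k = arccos ∘ fun x => cos x / Real.sqrt (polarDen k x) := rfl
  rw [heqf]
  refine harc.congr_deriv ?_
  -- simplify the derivative
  have h1f : 1 - (cos u / Real.sqrt (polarDen k u)) ^ 2 =
      (k * sin u / Real.sqrt (polarDen k u)) ^ 2 := by
    rw [div_pow, div_pow, hs2]
    field_simp
    unfold polarDen; ring
  have hsq : Real.sqrt (1 - (cos u / Real.sqrt (polarDen k u)) ^ 2) =
      k * sin u / Real.sqrt (polarDen k u) := by
    rw [h1f, Real.sqrt_sq (div_nonneg (mul_nonneg hk.le hsin.le) hs0.le)]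
  rw [hsq]
  set s := Real.sqrt (polarDen k u) with hs
  have hs2' : s ^ 2 = cos u ^ 2 + k ^ 2 * sin u ^ 2 := hs2
  rw [← hs2]
  have hks : k * sin u ≠ 0 := (mul_pos hk hsin).ne'
  field_simp
  linear_combination hs2' + k ^ 2 * sin_sq_add_cos_sq u

/-- Differentiability on `(0, π)`. [folklore] -/
theorem differentiableAt_polarAngle {k u : ℝ} (hk : 0 < k) (hu0 : 0 < u) (huπ : u < π) :
    DifferentiableAt ℝ (polarAngle k) u :=
  (hasDerivAt_polarAngle hk hu0 huπ).differentiableAt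

/-- `deriv A_k = k / D_k` on `(0, π)`. [folklore] -/
theorem deriv_polarAngle {k u : ℝ} (hk : 0 < k) (hu0 : 0 < u) (huπ : u < π) :
    deriv (polarAngle k) u = k / polarDen k u :=
  (hasDerivAt_polarAngle hk hu0 huπ).deriv

/-! ### The endpoint lemma -/

/-- `D_k` decreases as `sin²` increases (`k² ≤ 1`). [folklore] -/
theorem polarDen_le_polarDen_of_sin_sq_le {k : ℝ} (hk : k ^ 2 ≤ 1) {u v : ℝ}
    (h : sin u ^ 2 ≤ sin v ^ 2) : polarDen k v ≤ polarDen k u := by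
  rw [polarDen_eq, polarDen_eq]; nlinarith

/-- **The endpoint lemma.**  For `0 < k < 1` (so `k² ≤ 1`), `0 < S < π` and
`a ≤ t ≤ S − a` (`0 ≤ a`): `A_k(t) + A_k(S − t) ≤ A_k(a) + A_k(S − a)`.  Proof: on
`[a, S/2]` the derivative `k/D(t) − k/D(S − t)` is `≤ 0` because `sin t ≤ sin (S − t)` there,
and the function is symmetric under `t ↦ S − t`. [folklore] -/
theorem polarAngle_add_polarAngle_le {k S a t : ℝ} (hk0 : 0 < k) (hk1 : k ≤ 1) (hS0 : 0 < S)
    (hSπ : S < π) (ha : 0 ≤ a) (hat : a ≤ t) (htS : t ≤ S - a) :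
    polarAngle k t + polarAngle k (S - t) ≤ polarAngle k a + polarAngle k (S - a) := by
  have hk2 : k ^ 2 ≤ 1 := by nlinarith
  -- `F t = A t + A (S - t)` is antitone on `[a, S/2]`
  have hanti : AntitoneOn (fun x => polarAngle k x + polarAngle k (S - x)) (Icc a (S / 2)) := by
    have hcont : ContinuousOn (fun x => polarAngle k x + polarAngle k (S - x)) (Icc a (S / 2)) := by
      have hc := continuous_polarAngle hk0.ne'
      exact (hc.add (hc.comp (continuous_const.sub continuous_id))).continuousOn
    have hder : ∀ x ∈ Ioo a (S / 2), HasDerivAt (fun x => polarAngle k x + polarAngle k (S - x))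
        (k / polarDen k x + -(k / polarDen k (S - x))) x := by
      intro x hx
      have hx0 : 0 < x := lt_of_le_of_lt ha hx.1
      have hxπ : x < π := by linarith [hx.2]
      have h1 := hasDerivAt_polarAngle hk0 hx0 hxπ
      have hS1 : 0 < S - x := by linarith [hx.2]
      have hS2 : S - x < π := by linarith
      have h2 : HasDerivAt (fun y => polarAngle k (S - y)) (-(k / polarDen k (S - x))) x :=
        HasDerivAt.comp_const_sub S x (hasDerivAt_polarAngle hk0 hS1 hS2)
      exact h1.fun_add h2
    refine antitoneOn_of_deriv_nonpos (convex_Icc a (S / 2)) hcont ?_ ?_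
    · rw [interior_Icc]
      exact fun x hx => (hder x hx).differentiableAt.differentiableWithinAt
    · rw [interior_Icc]
      intro x hx
      rw [(hder x hx).deriv, ← sub_eq_add_neg, sub_nonpos]
      have hx0 : 0 < x := lt_of_le_of_lt ha hx.1
      -- `sin x ≤ sin (S - x)` on `(0, S/2)`
      have hsin : sin x ^ 2 ≤ sin (S - x) ^ 2 := by
        have hsx : 0 ≤ sin x := sin_nonneg_of_nonneg_of_le_pi hx0.le (by linarith [hx.2])
        have hdiff : 0 ≤ sin (S - x) - sin x := by
          rw [sin_sub_sin]
          have h1 : 0 ≤ sin ((S - x - x) / 2) :=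
            sin_nonneg_of_nonneg_of_le_pi (by linarith [hx.2]) (by linarith [hx.2])
          have h2 : 0 ≤ cos ((S - x + x) / 2) := by
            rw [show (S - x + x) / 2 = S / 2 by ring]
            exact cos_nonneg_of_neg_pi_div_two_le_of_le (by linarith) (by linarith)
          positivity
        nlinarith
      have hDx := polarDen_pos hk0.ne' x
      have hDS := polarDen_pos hk0.ne' (S - x)
      exact div_le_div_of_nonneg_left hk0.le hDS (polarDen_le_polarDen_of_sin_sq_le hk2 hsin)
  rcases le_or_gt t (S / 2) with h | h
  · exact hanti ⟨le_rfl, by linarith⟩ ⟨hat, h⟩ hat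
  · have hsymm : polarAngle k t + polarAngle k (S - t) =
        polarAngle k (S - t) + polarAngle k (S - (S - t)) := by rw [sub_sub_cancel, add_comm]
    rw [hsymm]
    exact hanti ⟨le_rfl, by linarith⟩ ⟨by linarith, by linarith⟩ (by linarith)

/-! ### Concavity of `u − A_k(u)` on `[0, π/2]` -/

/-- **`u ↦ u − A_k(u)` is concave on `[0, π/2]`** (`0 < k ≤ 1`): its derivative
`1 − k/D_k(u)` decreases since `D_k` decreases there. [folklore] -/
theorem concaveOn_sub_polarAngle {k : ℝ} (hk0 : 0 < k) (hk1 : k ≤ 1) :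
    ConcaveOn ℝ (Icc 0 (π / 2)) (fun u => u - polarAngle k u) := by
  have hk2 : k ^ 2 ≤ 1 := by nlinarith
  have hder : ∀ u ∈ Ioo 0 (π / 2), HasDerivAt (fun u => u - polarAngle k u) (1 - k / polarDen k u) u := by
    intro u hu
    exact (hasDerivAt_id u).fun_sub (hasDerivAt_polarAngle hk0 hu.1 (by linarith [hu.2, pi_pos]))
  refine AntitoneOn.concaveOn_of_deriv (convex_Icc 0 (π / 2)) ?_ ?_ ?_
  · exact (continuous_id.sub (continuous_polarAngle hk0.ne')).continuousOn
  · rw [interior_Icc]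
    exact fun u hu => (hder u hu).differentiableAt.differentiableWithinAt
  · rw [interior_Icc]
    intro u hu v hv huv
    rw [(hder u hu).deriv, (hder v hv).deriv]
    have hsin : sin u ^ 2 ≤ sin v ^ 2 := by
      have hsu : 0 ≤ sin u := sin_nonneg_of_nonneg_of_le_pi hu.1.le (by linarith [hu.2, pi_pos])
      have hle : sin u ≤ sin v :=
        sin_le_sin_of_le_of_le_pi_div_two (by linarith [hu.1, pi_pos]) (by linarith [hv.2]) huv
      nlinarith
    have hDu := polarDen_pos hk0.ne' u
    have hDv := polarDen_pos hk0.ne' v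
    have := div_le_div_of_nonneg_left hk0.le hDv (polarDen_le_polarDen_of_sin_sq_le hk2 hsin)
    linarith

/-- Hence on a subinterval `[u₁, u₂] ⊆ [0, π/2]` the function `u − A_k(u)` is at least its
smaller endpoint value. [folklore] -/
theorem min_le_sub_polarAngle {k u₁ u₂ u : ℝ} (hk0 : 0 < k) (hk1 : k ≤ 1) (h1 : 0 ≤ u₁)
    (h12 : u₁ ≤ u) (h2u : u ≤ u₂) (h2 : u₂ ≤ π / 2) :
    min (u₁ - polarAngle k u₁) (u₂ - polarAngle k u₂) ≤ u - polarAngle k u :=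
  (concaveOn_sub_polarAngle hk0 hk1).min_le_of_mem_Icc ⟨h1, by linarith⟩ ⟨by linarith, h2⟩
    ⟨h12, h2u⟩

/-! ### The identity `A_k(α) − A_k(α/2) = α/2` for `cos α = k/(1+k)` -/

/-- For `cos α = k/(1 + k)` (`0 < k`): `D_k(α/2) = (1 + k)/2` … [folklore] -/
theorem polarDen_half_of_cos_eq {k α : ℝ} (hk : 0 < k) (hα : cos α = k / (1 + k)) :
    polarDen k (α / 2) = (1 + k) / 2 := by
  have h1k : (1 + k) ≠ 0 := by positivity
  have hc : cos (α / 2) ^ 2 = 1 / 2 + cos α / 2 := by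
    rw [cos_sq (α / 2), show 2 * (α / 2) = α by ring]
  have hs : sin (α / 2) ^ 2 = 1 / 2 - cos α / 2 := by
    nlinarith [sin_sq_add_cos_sq (α / 2)]
  unfold polarDen
  rw [hc, hs, hα]
  field_simp
  ring

/-- … and `D_k(α) = 2k²/(1 + k)`. [folklore] -/
theorem polarDen_of_cos_eq {k α : ℝ} (hk : 0 < k) (hα : cos α = k / (1 + k)) :
    polarDen k α = 2 * k ^ 2 / (1 + k) := by
  have h1k : (1 + k) ≠ 0 := by positivity
  have hs : sin α ^ 2 = 1 - cos α ^ 2 := by nlinarith [sin_sq_add_cos_sq α]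
  unfold polarDen
  rw [hs, hα]
  field_simp
  ring

/-- **`A_k(α) − A_k(α/2) = α/2` when `cos α = k/(1 + k)`, `0 < k`, `0 < α < π`.**  (The
isosceles spherical triangle with legs `d`, `k = cos d`, and apex angle `2α(d)` has the area
`2(α − A_k(α)) = 2(α/2 − A_k(α/2))` of the equilateral triangle of side `d`, whose angle is
`α(d) = arccos (k/(1+k))`.) [folklore] -/
theorem polarAngle_sub_polarAngle_half {k α : ℝ} (hk : 0 < k) (hα0 : 0 < α) (hαπ : α < π)
    (hα : cos α = k / (1 + k)) : polarAngle k α - polarAngle k (α / 2) = α / 2 := by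
  have h1k : 0 < 1 + k := by positivity
  have hcosα : 0 < cos α := by rw [hα]; positivity
  -- so `α < π/2`
  have hαlt : α < π / 2 := by
    by_contra h
    push Not at h
    have := cos_nonpos_of_pi_div_two_le_of_le h (by linarith)
    linarith
  set a := polarAngle k α with ha
  set b := polarAngle k (α / 2) with hb
  have hDα := polarDen_of_cos_eq hk hα
  have hDh := polarDen_half_of_cos_eq hk hα
  have hsα : 0 < sin α := sin_pos_of_pos_of_lt_pi hα0 hαπ
  have hsh : 0 < sin (α / 2) := sin_pos_of_pos_of_lt_pi (by linarith) (by linarith)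
  have hch : 0 < cos (α / 2) := cos_pos_of_mem_Ioo ⟨by linarith, by linarith⟩
  -- cos and sin of `a`, `b`
  have hca : cos a = cos α / Real.sqrt (polarDen k α) := cos_polarAngle k α
  have hsa : sin a = k * sin α / Real.sqrt (polarDen k α) :=
    sin_polarAngle hk.ne' (mul_nonneg hk.le hsα.le)
  have hcb : cos b = cos (α / 2) / Real.sqrt (polarDen k (α / 2)) := cos_polarAngle k (α / 2)
  have hsb : sin b = k * sin (α / 2) / Real.sqrt (polarDen k (α / 2)) :=
    sin_polarAngle hk.ne' (mul_nonneg hk.le hsh.le)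
  -- the product of the two square roots is `k`
  set p := Real.sqrt (polarDen k α) with hp
  set q := Real.sqrt (polarDen k (α / 2)) with hq
  have hp0 : 0 < p := Real.sqrt_pos.2 (polarDen_pos hk.ne' α)
  have hq0 : 0 < q := Real.sqrt_pos.2 (polarDen_pos hk.ne' (α / 2))
  have hpq : p * q = k := by
    have h2 : (p * q) ^ 2 = k ^ 2 := by
      rw [mul_pow, hp, hq, Real.sq_sqrt (polarDen_pos hk.ne' α).le,
        Real.sq_sqrt (polarDen_pos hk.ne' (α / 2)).le, hDα, hDh]
      field_simp
    have := (pow_left_inj₀ (mul_nonneg hp0.le hq0.le) hk.le two_ne_zero).1 h2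
    exact this
  -- half-angle relations
  have hcos2 : cos α = 2 * cos (α / 2) ^ 2 - 1 := by
    rw [cos_sq (α / 2), show 2 * (α / 2) = α by ring]; ring
  have hsin2 : sin α = 2 * sin (α / 2) * cos (α / 2) := by
    rw [← sin_two_mul, show 2 * (α / 2) = α by ring]
  -- `cos (a - b) = cos (α/2)` and `sin (a - b) = sin (α/2)`
  have hcos : cos (a - b) = cos (α / 2) := by
    rw [cos_sub, hca, hsa, hcb, hsb]
    rw [div_mul_div_comm, div_mul_div_comm, hpq, ← add_div, div_eq_iff hk.ne']
    -- `cos α cos(α/2) + k² sin α sin(α/2) = k cos(α/2)`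
    rw [hsin2]
    have hk1 : cos α * (1 + k) = k := by rw [hα]; field_simp
    have hsh2 : sin (α / 2) ^ 2 = 1 - cos (α / 2) ^ 2 := by nlinarith [sin_sq_add_cos_sq (α / 2)]
    linear_combination (2 * k ^ 2 * cos (α / 2)) * hsh2 + (k ^ 2 * cos (α / 2)) * hcos2 +
      ((1 - k) * cos (α / 2)) * hk1
  have hsin : sin (a - b) = sin (α / 2) := by
    rw [sin_sub, hca, hsa, hcb, hsb]
    rw [div_mul_div_comm, div_mul_div_comm, hpq, ← sub_div, div_eq_iff hk.ne']
    rw [hsin2, hcos2]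
    ring
  -- ranges: `a, b ∈ [0, π/2]`, so `a - b ∈ [-π/2, π/2]`; with `sin (a - b) > 0` it is in `(0, π/2]`
  have ha1 : a ≤ π / 2 := polarAngle_le_pi_div_two k hcosα.le
  have ha0 : 0 ≤ a := polarAngle_nonneg k α
  have hb1 : b ≤ π / 2 := polarAngle_le_pi_div_two k hch.le
  have hb0 : 0 ≤ b := polarAngle_nonneg k (α / 2)
  have hpos : 0 < a - b := by
    by_contra h
    push Not at h
    have : sin (a - b) ≤ 0 := sin_nonpos_of_nonpos_of_neg_pi_le h (by linarith)
    rw [hsin] at this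
    linarith
  exact injOn_cos ⟨hpos.le, by linarith⟩ ⟨by linarith, by linarith⟩ hcos

/-- **`A_k(α/2) = π/2 − α` when `cos α = k/(1 + k)`** (`0 < k`, `0 < α < π`): the base angles of
the equilateral spherical triangle of side `d` (`k = cos d`, angle `α = α(d)`) are `α`.
[folklore] -/
theorem polarAngle_half_of_cos_eq {k α : ℝ} (hk : 0 < k) (hα0 : 0 < α) (hαπ : α < π)
    (hα : cos α = k / (1 + k)) : polarAngle k (α / 2) = π / 2 - α := by
  have h1k : 0 < 1 + k := by positivity
  have hcosα : 0 < cos α := by rw [hα]; positivity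
  have hαlt : α < π / 2 := by
    by_contra h
    push Not at h
    have := cos_nonpos_of_pi_div_two_le_of_le h (by linarith)
    linarith
  have hch : 0 < cos (α / 2) := cos_pos_of_mem_Ioo ⟨by linarith, by linarith⟩
  have hsh : 0 < sin (α / 2) := sin_pos_of_pos_of_lt_pi (by linarith) (by linarith)
  have hDh := polarDen_half_of_cos_eq hk hα
  -- `cos` of both sides
  have hL : cos (polarAngle k (α / 2)) = cos (α / 2) / Real.sqrt ((1 + k) / 2) := by
    rw [cos_polarAngle, hDh]
  have hR : cos (π / 2 - α) = 2 * sin (α / 2) * cos (α / 2) := by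
    rw [cos_pi_div_two_sub, ← sin_two_mul, show 2 * (α / 2) = α by ring]
  have hs2 : sin (α / 2) ^ 2 = 1 / (2 * (1 + k)) := by
    have hc2 : cos (α / 2) ^ 2 = 1 / 2 + cos α / 2 := by
      rw [cos_sq (α / 2), show 2 * (α / 2) = α by ring]
    have : sin (α / 2) ^ 2 = 1 / 2 - cos α / 2 := by
      nlinarith [sin_sq_add_cos_sq (α / 2)]
    rw [this, hα]; field_simp; ring
  have hsq : Real.sqrt ((1 + k) / 2) * (2 * sin (α / 2)) = 1 := by
    have hnn : 0 ≤ Real.sqrt ((1 + k) / 2) * (2 * sin (α / 2)) := by positivity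
    have h2 : (Real.sqrt ((1 + k) / 2) * (2 * sin (α / 2))) ^ 2 = 1 := by
      rw [mul_pow, Real.sq_sqrt (by positivity), mul_pow, hs2]
      field_simp
    nlinarith [h2, hnn]
  have hcos : cos (polarAngle k (α / 2)) = cos (π / 2 - α) := by
    rw [hL, hR, div_eq_iff (Real.sqrt_pos.2 (by positivity)).ne']
    nlinarith [hsq]
  exact injOn_cos ⟨polarAngle_nonneg k _, by linarith [polarAngle_le_pi_div_two k hch.le]⟩
    ⟨by linarith, by linarith⟩ hcos

/-- **`A_k(α) = π/2 − α/2` when `cos α = k/(1 + k)`** (`0 < k`, `0 < α < π`). [folklore] -/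
theorem polarAngle_of_cos_eq {k α : ℝ} (hk : 0 < k) (hα0 : 0 < α) (hαπ : α < π)
    (hα : cos α = k / (1 + k)) : polarAngle k α = π / 2 - α / 2 := by
  have h1 := polarAngle_sub_polarAngle_half hk hα0 hαπ hα
  have h2 := polarAngle_half_of_cos_eq hk hα0 hαπ hα
  linarith

end Literature.Geometry.DiscreteGeometry
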